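import Summits.CriticalPhenomena.CardyFormulaZ2.Theses.CardySelfRefinement
import Literature.Probability.Percolation.KSTPeriodicWeakPos
import HarnessLib.Audit

/-!
# Crux `CriticalPathRSW`, line finite-size-envelope: stub `stub_kstWeakAssemblyPos`

The assembly of the weak periodic Köhler-Schindler–Tassion RSW theorem from its five steps, with
the cascading step in its positive-scale form `KSTPeriodic.CascadeStepPos`: a wrapper around
`KSTPeriodic.weakPeriodicRSW_of_pos` (`Literature/Probability/Percolation/KSTPeriodicWeakPos.lean`).
-/

namespace Summit.CriticalPhenomena.CardyFormulaZ2.Cruxes.CriticalPathRSW.FiniteSizeEnvelope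

open Literature.Probability.Percolation

/-- **Registered stub `stub_kstWeakAssemblyPos`** of the line `finite-size-envelope`: the five
steps (with Lemma 4 at positive scales) imply `WeakPeriodicRSW k t` for every period `k ≥ 1` and
offset `t`. [cite: KohlerSchindlerTassion2023, Theorem 1, §2 and §5.2] -/
theorem stub_kstWeakAssemblyPos :
    ∀ k t : ℕ, 1 ≤ k → KSTPeriodic.ArmsOfShortCrossings k t → KSTPeriodic.QuasiOfArms k t →
      KSTPeriodic.ClosingIneq k t → KSTPeriodic.CascadeStepPos k t →
      KSTPeriodic.BridgesGiveCrossings k t → KSTPeriodic.WeakPeriodicRSW k t :=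
  fun _ _ hk hA hQ hC hS hB => KSTPeriodic.weakPeriodicRSW_of_pos hk hA hQ hC hS hB

end Summit.CriticalPhenomena.CardyFormulaZ2.Cruxes.CriticalPathRSW.FiniteSizeEnvelope
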